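import Literature.Analysis.FluidPDE.SelfSimilarEulerLpTwoScale
import Literature.Analysis.FluidPDE.AssociatedPressureLocalBound
import HarnessLib

/-!
# Chae–Shvydkoy 2013, Theorem 3.2 for every `3 ≤ p < ∞`: the bootstrap, and the discharge
# `chaeShvydkoy2013_Lp_exclusion_holds`

Analysis/FluidPDE proof file (theorems only; no definitions, no named facts, no `sorry`): the
DISCHARGE of the NAMED FACT `chaeShvydkoy2013_Lp_exclusion` (`SelfSimilarEulerLpExclusion.lean`) —

* D. Chae, R. Shvydkoy, *On formation of a locally self-similar collapse in the incompressible
  Euler equations*, Arch. Ration. Mech. Anal. **209** (2013) 999–1017 = arXiv:1201.6009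
  [ChaeShvydkoy2013], **Theorem 3.2** (`N = 3`, `C²` profiles, `3 ≤ p < ∞`): a stationary
  self-similar Euler profile `(U, P)` with exponent `γ = 1/(α+1)`, `U ∈ L^p`, associated pressure
  `P ∈ L^{p/2}` (weak Poisson equation), and `−1 < α ≤ 3/p` or `α > 3/2`, is trivial —

following the printed proof (§3.2.1–§3.2.2) on top of its two earlier stages in the tree:
`SelfSimilarEulerLpTwoScale.lean` (the bootstrap-ready inequalities CS13 (3.2)/(3.9) and the first
growth bound `∫_{|y|<L}|U|² ≲ L^{β_p}`, `β_p = 2 − 9/p`, CS13 (3.3)) and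
`AssociatedPressureLocalBound.lean` (Lemma 3.3 in structural form). The bootstrap (CS13 (3.4)–(3.8)
and (3.10)–(3.11)):

1. `setIntegral_norm_rpow_three_le_of_growth` — CS13 (3.4): "by interpolation,
   `∫_{|y|≤L}|v|³ ≤ C L^{β_p α_p}`, where `α_p = (p−3)/(p−2)`" (Hölder between the local `L²`
   growth and the global `L^p` bound);
2. `setIntegral_compl_ball_le_of_dyadic` — the dyadic summation device
   (`Σ_k 2^{ke} = (1 − 2^e)^{−1}`, `e < 0`) behind CS13's "`Σ_{k=1}^∞ (2^{ka₂}L^{a₂})/2^{Nk}`" and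
   "`Σ_{k=0}^∞ 2^{k(β_pα_p − N − 1 + 2α)}`";
3. `setIntegral_abs_rpow_threeHalves_le_of_growth` — Lemma 3.3 with CS13's exponents: growth `a₂`
   with `a₂ ≤ N − 2N/p` gives `∫_{|y|≤L}|q|^{3/2} ≲ L^{a₂α_p}` (CS13 (3.5)–(3.6): "they are verified
   for any couple `a₂ ≤ N − 2N/p`, `a₃ = a₂α_p`");
4. `energyGrowth_step` — one round of the bootstrap in either range: growth exponent
   `a ↦ α_p a − 1` (CS13 (3.7): "`∫_{|y|≤L}|v|² ≤ CL^{β_pα_p − 1}`", and "Substituting this into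
   (3.2) we obtain … and so on"; in the range `α > N/2` the single-cut-off form (3.9) gives the same
   recursion without the logarithmic case of the printed (3.10)–(3.11));
5. `exists_energyGrowth_neg` — "For `n` sufficiently large the power
   `β_pα_pⁿ − α_p^{n−1} − … − 1` will become negative implying that `v = 0`": the recursion drops
   by at least `1` while nonnegative, so some iterate is negative; then
   `eq_zero_of_energyGrowth_of_three_halves_lt`;
6. `IsSelfSimilarEulerProfile.eq_zero_of_memLp` (all `3 < p < ∞`, both ranges) and
   **`chaeShvydkoy2013_Lp_exclusion_holds : chaeShvydkoy2013_Lp_exclusion`** (`p = 3` by the tree's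
   `chaeShvydkoy2013_L3_exclusion`).

Not here (still named facts of `SelfSimilarEulerLpExclusion.lean`): Cor. 3.4 for general `p` and the
endpoint `α = 3/2` (`chaeShvydkoy2013_energy_growth`; the window `N/p < α ≤ N/2` version of the
same bootstrap), Thm. 4.1 (`chaeShvydkoy2013_vorticity_exclusion`).

## Mathlib / tree search

Reused: `IsSelfSimilarEulerProfile.ball_energy_le_weightedFlux`, `….ball_energy_le_localFlux`,
`….energyGrowth_first_of_le`, `….energyGrowth_first_of_gt_three_halves`, `memLp_flux_of_memLp`,
`setIntegral_weight_mul_flux_le` (`SelfSimilarEulerLpTwoScale.lean`);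
`exists_setIntegral_abs_rpow_threeHalves_le`, `integrableOn_norm_sq_div_norm_cube`
(`AssociatedPressureLocalBound.lean`); `eq_zero_of_energyGrowth_of_three_halves_lt`
(`SelfSimilarEulerLpExclusion.lean`); `chaeShvydkoy2013_L3_exclusion`
(`SelfSimilarEulerL3Exclusion.lean`); `memLp_restrict_of_continuous_isBounded`
(`SteadyNSCaccioppoliTools.lean`); Mathlib `integral_mul_le_Lp_mul_Lq_of_nonneg`,
`tendsto_setIntegral_of_monotone`, `setIntegral_union`, `Nat.find`, `Real.rpow_*`.
No new definitions, no instances, no notation.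
-/

noncomputable section

open MeasureTheory Set Filter Topology Metric
open scoped ENNReal NNReal Laplacian

namespace Literature.Analysis.FluidPDE

/-! ## Tools: dyadic tails, local Hölder bounds -/

/-- **Dyadic summation of annular bounds.** If `w` is integrable on `{|y| ≥ l}` (`l > 0`) and
`∫_{ρ ≤ |y| < 2ρ} w ≤ C ρ^e` for every `ρ ≥ l`, with `e < 0`, then
`∫_{|y| ≥ l} w ≤ C l^e (1 − 2^e)^{−1}`. [folklore] -/
private theorem setIntegral_compl_ball_le_of_dyadic {w : EuclideanSpace ℝ (Fin 3) → ℝ}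
    {l C e : ℝ} (hl : 0 < l) (he : e < 0) (hC : 0 ≤ C)
    (hwi : IntegrableOn w (ball (0 : EuclideanSpace ℝ (Fin 3)) l)ᶜ volume)
    (hann : ∀ ρ : ℝ, l ≤ ρ →
      ∫ y in {y : EuclideanSpace ℝ (Fin 3) | ρ ≤ ‖y‖ ∧ ‖y‖ < 2 * ρ}, w y ≤ C * ρ ^ e) :
    ∫ y in (ball (0 : EuclideanSpace ℝ (Fin 3)) l)ᶜ, w y ≤ C * l ^ e * (1 - (2 : ℝ) ^ e)⁻¹ := by
  have hq : (2 : ℝ) ^ e < 1 := Real.rpow_lt_one_of_one_lt_of_neg (by norm_num) he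
  have hq0 : 0 < (2 : ℝ) ^ e := Real.rpow_pos_of_pos two_pos _
  have hle : 0 ≤ l ^ e := Real.rpow_nonneg hl.le _
  -- the truncated integrals
  set T : ℕ → Set (EuclideanSpace ℝ (Fin 3)) :=
    fun N => {y : EuclideanSpace ℝ (Fin 3) | l ≤ ‖y‖ ∧ ‖y‖ < 2 ^ N * l} with hT
  have hTm : ∀ N, MeasurableSet (T N) := fun N =>
    (isClosed_le continuous_const continuous_norm).measurableSet.inter
      (isOpen_lt continuous_norm continuous_const).measurableSet
  have hTsub : ∀ N, T N ⊆ (ball (0 : EuclideanSpace ℝ (Fin 3)) l)ᶜ := fun N y hy => by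
    rw [mem_compl_iff, mem_ball_zero_iff, not_lt]
    exact hy.1
  have hclaim : ∀ N : ℕ,
      ∫ y in T N, w y ≤ C * l ^ e * ((1 - ((2 : ℝ) ^ e) ^ N) / (1 - (2 : ℝ) ^ e)) := by
    intro N
    induction N with
    | zero =>
      have h0 : T 0 = ∅ := by
        ext y
        simp only [hT, pow_zero, one_mul, mem_setOf_eq, mem_empty_iff_false, iff_false, not_and,
          not_lt]
        exact fun h => h
      rw [h0, Measure.restrict_empty, integral_zero_measure]
      simp
    | succ N ih =>
      -- `T (N+1) = T N ∪ {2^N l ≤ |y| < 2^{N+1} l}`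
      set ρ : ℝ := 2 ^ N * l with hρ
      have hρl : l ≤ ρ := by
        rw [hρ]
        have : (1 : ℝ) ≤ 2 ^ N := one_le_pow₀ (by norm_num)
        nlinarith
      have hsplit : T (N + 1) = T N ∪ {y : EuclideanSpace ℝ (Fin 3) | ρ ≤ ‖y‖ ∧ ‖y‖ < 2 * ρ} := by
        ext y
        simp only [hT, mem_setOf_eq, mem_union, pow_succ]
        constructor
        · rintro ⟨h1, h2⟩
          by_cases h3 : ‖y‖ < 2 ^ N * l
          · exact Or.inl ⟨h1, h3⟩
          · push Not at h3
            refine Or.inr ⟨by rw [hρ]; exact h3, by rw [hρ]; linarith⟩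
        · rintro (⟨h1, h2⟩ | ⟨h1, h2⟩)
          · exact ⟨h1, by nlinarith [hq0]⟩
          · exact ⟨le_trans hρl h1, by rw [hρ] at h2; linarith⟩
      have hdisj : Disjoint (T N) {y : EuclideanSpace ℝ (Fin 3) | ρ ≤ ‖y‖ ∧ ‖y‖ < 2 * ρ} := by
        rw [Set.disjoint_left]
        intro y hy hy'
        exact absurd hy.2 (not_lt.2 hy'.1)
      have hAm : MeasurableSet {y : EuclideanSpace ℝ (Fin 3) | ρ ≤ ‖y‖ ∧ ‖y‖ < 2 * ρ} :=
        (isClosed_le continuous_const continuous_norm).measurableSet.inter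
          (isOpen_lt continuous_norm continuous_const).measurableSet
      have hAsub : {y : EuclideanSpace ℝ (Fin 3) | ρ ≤ ‖y‖ ∧ ‖y‖ < 2 * ρ} ⊆
          (ball (0 : EuclideanSpace ℝ (Fin 3)) l)ᶜ := fun y hy => by
        rw [mem_compl_iff, mem_ball_zero_iff, not_lt]
        exact le_trans hρl hy.1
      rw [hsplit, setIntegral_union hdisj hAm (hwi.mono_set (hTsub N)) (hwi.mono_set hAsub)]
      have hA := hann ρ hρl
      have hρe : ρ ^ e = l ^ e * ((2 : ℝ) ^ e) ^ N := by
        rw [hρ, Real.mul_rpow (by positivity) hl.le, ← Real.rpow_natCast,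
          ← Real.rpow_mul (by norm_num), mul_comm (N : ℝ) e, Real.rpow_mul (by norm_num),
          Real.rpow_natCast]
        ring
      rw [hρe] at hA
      have hne : (1 : ℝ) - 2 ^ e ≠ 0 := by linarith
      calc (∫ y in T N, w y) + ∫ y in {y : EuclideanSpace ℝ (Fin 3) | ρ ≤ ‖y‖ ∧ ‖y‖ < 2 * ρ}, w y
          ≤ C * l ^ e * ((1 - ((2 : ℝ) ^ e) ^ N) / (1 - (2 : ℝ) ^ e)) +
              C * (l ^ e * ((2 : ℝ) ^ e) ^ N) := add_le_add ih hA
        _ = C * l ^ e * ((1 - ((2 : ℝ) ^ e) ^ (N + 1)) / (1 - (2 : ℝ) ^ e)) := by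
            field_simp
            ring
  -- uniform bound and the limit `N → ∞`
  have hunif : ∀ N : ℕ, ∫ y in T N, w y ≤ C * l ^ e * (1 - (2 : ℝ) ^ e)⁻¹ := by
    intro N
    refine (hclaim N).trans ?_
    have hqN : 0 ≤ ((2 : ℝ) ^ e) ^ N := pow_nonneg hq0.le N
    have h1 : (1 - ((2 : ℝ) ^ e) ^ N) / (1 - (2 : ℝ) ^ e) ≤ (1 - (2 : ℝ) ^ e)⁻¹ := by
      rw [div_eq_mul_inv]
      exact mul_le_of_le_one_left (inv_nonneg.2 (by linarith)) (by linarith)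
    exact mul_le_mul_of_nonneg_left h1 (by positivity)
  have hmono : Monotone T := by
    intro m n hmn y hy
    refine ⟨hy.1, lt_of_lt_of_le hy.2 ?_⟩
    exact mul_le_mul_of_nonneg_right (pow_le_pow_right₀ (by norm_num) hmn) hl.le
  have hunion : (⋃ N, T N) = (ball (0 : EuclideanSpace ℝ (Fin 3)) l)ᶜ := by
    ext y
    simp only [mem_iUnion, hT, mem_setOf_eq, mem_compl_iff, mem_ball_zero_iff, not_lt]
    constructor
    · rintro ⟨N, hN⟩
      exact hN.1
    · intro hy
      obtain ⟨N, hN⟩ := pow_unbounded_of_one_lt (‖y‖ / l) (by norm_num : (1 : ℝ) < 2)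
      exact ⟨N, hy, by rwa [div_lt_iff₀ hl] at hN⟩
  have hlim := tendsto_setIntegral_of_monotone (μ := volume) (f := w) hTm hmono
    (by rw [hunion]; exact hwi)
  rw [hunion] at hlim
  exact le_of_tendsto' hlim hunif

/-- **CS13 (3.4): local `L³` by interpolation.** For `U` continuous with `U ∈ L^p`, `p > 3`:
`∫_{|y|<R} |U|³ ≤ (∫_{|y|<R} |U|²)^{α_p} (∫ |U|^p)^{1/(p−2)}`, `α_p = (p−3)/(p−2)` (Hölder with
the split `|U|³ = |U|^{2α_p} |U|^{p/(p−2)}`, exponents `(p−2)/(p−3)` and `p − 2`).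
[cite: ChaeShvydkoy2013, §3.2.1 eq. (3.4)] -/
theorem setIntegral_norm_rpow_three_le_interpolation {p : ℝ} (hp : 3 < p)
    {U : EuclideanSpace ℝ (Fin 3) → EuclideanSpace ℝ (Fin 3)} (hUc : Continuous U)
    (hU : MemLp U (ENNReal.ofReal p) volume) {R : ℝ} :
    ∫ y in ball (0 : EuclideanSpace ℝ (Fin 3)) R, ‖U y‖ ^ (3 : ℝ) ≤
      (∫ y in ball (0 : EuclideanSpace ℝ (Fin 3)) R, ‖U y‖ ^ 2) ^ ((p - 3) / (p - 2)) *
        (∫ y, ‖U y‖ ^ p) ^ (1 / (p - 2)) := by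
  have hp0 : 0 < p := by linarith
  have hp2 : 0 < p - 2 := by linarith
  have hp3 : 0 < p - 3 := by linarith
  have ha0 : 0 < 2 * (p - 3) / (p - 2) := by positivity
  have hb0 : 0 < p / (p - 2) := by positivity
  have hab : 2 * (p - 3) / (p - 2) + p / (p - 2) = 3 := by
    rw [← add_div, div_eq_iff hp2.ne']
    ring
  have haP : 2 * (p - 3) / (p - 2) * ((p - 2) / (p - 3)) = ((2 : ℕ) : ℝ) := by
    rw [div_mul_div_comm, div_eq_iff (mul_pos hp2 hp3).ne']
    push_cast
    ring
  have hbQ : p / (p - 2) * (p - 2) = p := div_mul_cancel₀ p hp2.ne'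
  have hPQ : Real.HolderConjugate ((p - 2) / (p - 3)) (p - 2) :=
    ⟨by rw [inv_div, inv_one, inv_eq_one_div, ← add_div, div_eq_iff hp2.ne']; ring,
      by positivity, hp2⟩
  have hS : Bornology.IsBounded (ball (0 : EuclideanSpace ℝ (Fin 3)) R) := isBounded_ball
  have hfa : Continuous fun y => ‖U y‖ ^ (2 * (p - 3) / (p - 2)) :=
    hUc.norm.rpow_const fun _ => Or.inr ha0.le
  have hgb : Continuous fun y => ‖U y‖ ^ (p / (p - 2)) :=
    hUc.norm.rpow_const fun _ => Or.inr hb0.le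
  have h := integral_mul_le_Lp_mul_Lq_of_nonneg (μ := volume.restrict (ball (0 : EuclideanSpace ℝ
    (Fin 3)) R)) hPQ (f := fun y => ‖U y‖ ^ (2 * (p - 3) / (p - 2)))
    (g := fun y => ‖U y‖ ^ (p / (p - 2)))
    (Eventually.of_forall fun y => Real.rpow_nonneg (norm_nonneg _) _)
    (Eventually.of_forall fun y => Real.rpow_nonneg (norm_nonneg _) _)
    (memLp_restrict_of_continuous_isBounded hfa hS _)
    (memLp_restrict_of_continuous_isBounded hgb hS _)
  -- rewrite the three integrands and the exponent `1/((p−2)/(p−3))`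
  have e1 : ∀ y : EuclideanSpace ℝ (Fin 3),
      ‖U y‖ ^ (2 * (p - 3) / (p - 2)) * ‖U y‖ ^ (p / (p - 2)) = ‖U y‖ ^ (3 : ℝ) := fun y => by
    rw [← Real.rpow_add_of_nonneg (norm_nonneg _) ha0.le hb0.le, hab]
  have e2 : ∀ y : EuclideanSpace ℝ (Fin 3),
      (‖U y‖ ^ (2 * (p - 3) / (p - 2))) ^ ((p - 2) / (p - 3)) = ‖U y‖ ^ 2 := fun y => by
    rw [← Real.rpow_mul (norm_nonneg _), haP, Real.rpow_natCast]
  have e3 : ∀ y : EuclideanSpace ℝ (Fin 3), (‖U y‖ ^ (p / (p - 2))) ^ (p - 2) = ‖U y‖ ^ p :=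
    fun y => by rw [← Real.rpow_mul (norm_nonneg _), hbQ]
  have e4 : 1 / ((p - 2) / (p - 3)) = (p - 3) / (p - 2) := one_div_div _ _
  simp only [e1, e2, e3, e4] at h
  refine h.trans ?_
  have hUpi : Integrable (fun y => ‖U y‖ ^ p) (volume : Measure (EuclideanSpace ℝ (Fin 3))) := by
    have h := hU.integrable_norm_rpow (by simp [hp0]) ENNReal.ofReal_ne_top
    rwa [ENNReal.toReal_ofReal hp0.le] at h
  have hI0 : 0 ≤ ∫ y in ball (0 : EuclideanSpace ℝ (Fin 3)) R, ‖U y‖ ^ p :=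
    integral_nonneg fun y => by positivity
  exact mul_le_mul_of_nonneg_left
    (Real.rpow_le_rpow hI0 (setIntegral_le_integral hUpi
      (Eventually.of_forall fun y => by positivity)) (by positivity))
    (Real.rpow_nonneg (integral_nonneg fun y => by positivity) _)

/-- **Hölder `(3/2, 3)` on a bounded set for an `L^{p/2}` pressure and a continuous field**:
`∫_S |P||U| ≤ (∫_S |P|^{3/2})^{2/3} (∫_S |U|³)^{1/3}` (`p ≥ 3`). [folklore] -/
private theorem setIntegral_abs_mul_norm_le {p : ℝ} (hp : 3 ≤ p)
    {U : EuclideanSpace ℝ (Fin 3) → EuclideanSpace ℝ (Fin 3)} {P : EuclideanSpace ℝ (Fin 3) → ℝ}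
    (hUc : Continuous U) (hP : MemLp P (ENNReal.ofReal (p / 2)) volume)
    {S : Set (EuclideanSpace ℝ (Fin 3))} (hS : Bornology.IsBounded S) :
    ∫ y in S, |P y| * ‖U y‖ ≤ (∫ y in S, |P y| ^ (3 / 2 : ℝ)) ^ (1 / (3 / 2) : ℝ) *
      (∫ y in S, ‖U y‖ ^ (3 : ℝ)) ^ (1 / 3 : ℝ) := by
  haveI : IsFiniteMeasure (volume.restrict S) := isFiniteMeasure_restrict.2 hS.measure_lt_top.ne
  have hpq : Real.HolderConjugate (3 / 2) 3 := ⟨by norm_num, by norm_num, by norm_num⟩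
  have hP32 : MemLp (fun y => |P y|) (ENNReal.ofReal (3 / 2)) (volume.restrict S) := by
    have h1 : MemLp P (ENNReal.ofReal (3 / 2)) (volume.restrict S) :=
      (hP.restrict S).mono_exponent (ENNReal.ofReal_le_ofReal (by linarith))
    simpa [Real.norm_eq_abs] using h1.norm
  have hU3 : MemLp (fun y => ‖U y‖) (ENNReal.ofReal 3) (volume.restrict S) :=
    (memLp_restrict_of_continuous_isBounded hUc hS _).norm
  exact integral_mul_le_Lp_mul_Lq_of_nonneg (μ := volume.restrict S) hpq
    (f := fun y => |P y|) (g := fun y => ‖U y‖)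
    (Eventually.of_forall fun y => abs_nonneg _) (Eventually.of_forall fun _ => norm_nonneg _)
    hP32 hU3

/-! ## Consequences of a growth bound `∫_{|y|<R} |U|² ≤ C R^a` (`R ≥ 1`) -/

/-- **CS13 (3.4) with exponents.** If `∫_{|y|<R}|U|² ≤ C R^a` for `R ≥ 1` and `U ∈ L^p` is
continuous, `p > 3`, then `∫_{|y|<R}|U|³ ≤ C' R^{α_p a}` for `R ≥ 1`, `α_p = (p−3)/(p−2)`.
[cite: ChaeShvydkoy2013, §3.2.1 eq. (3.4)] -/
theorem setIntegral_norm_cube_le_of_growth {p a C : ℝ} (hp : 3 < p) (hC : 0 ≤ C)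
    {U : EuclideanSpace ℝ (Fin 3) → EuclideanSpace ℝ (Fin 3)} (hUc : Continuous U)
    (hU : MemLp U (ENNReal.ofReal p) volume)
    (hG : ∀ R : ℝ, 1 ≤ R →
      ∫ y in ball (0 : EuclideanSpace ℝ (Fin 3)) R, ‖U y‖ ^ 2 ≤ C * R ^ a) :
    ∃ C' : ℝ, 0 ≤ C' ∧ ∀ R : ℝ, 1 ≤ R →
      ∫ y in ball (0 : EuclideanSpace ℝ (Fin 3)) R, ‖U y‖ ^ 3 ≤
        C' * R ^ ((p - 3) / (p - 2) * a) := by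
  have hp2 : 0 < p - 2 := by linarith
  have hκ0 : 0 ≤ (p - 3) / (p - 2) := div_nonneg (by linarith) hp2.le
  set N : ℝ := (∫ y, ‖U y‖ ^ p) ^ (1 / (p - 2)) with hN
  have hN0 : 0 ≤ N := Real.rpow_nonneg (integral_nonneg fun y => by positivity) _
  refine ⟨C ^ ((p - 3) / (p - 2)) * N, by positivity, fun R hR => ?_⟩
  have hR0 : 0 ≤ R := by linarith
  have h1 := setIntegral_norm_rpow_three_le_interpolation hp hUc hU (R := R)
  have e3 : ∀ y : EuclideanSpace ℝ (Fin 3), ‖U y‖ ^ (3 : ℝ) = ‖U y‖ ^ 3 := fun y => by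
    rw [show (3 : ℝ) = (3 : ℕ) by norm_num, Real.rpow_natCast]
  simp only [e3] at h1
  refine h1.trans ?_
  have hE0 : 0 ≤ ∫ y in ball (0 : EuclideanSpace ℝ (Fin 3)) R, ‖U y‖ ^ 2 :=
    integral_nonneg fun y => by positivity
  calc (∫ y in ball (0 : EuclideanSpace ℝ (Fin 3)) R, ‖U y‖ ^ 2) ^ ((p - 3) / (p - 2)) * N
      ≤ (C * R ^ a) ^ ((p - 3) / (p - 2)) * N :=
        mul_le_mul_of_nonneg_right (Real.rpow_le_rpow hE0 (hG R hR) hκ0) hN0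
    _ = C ^ ((p - 3) / (p - 2)) * N * R ^ ((p - 3) / (p - 2) * a) := by
        rw [Real.mul_rpow hC (Real.rpow_nonneg hR0 _), ← Real.rpow_mul hR0, mul_comm a]
        ring

/-- **Far tail from growth.** If `∫_{|y|<R}|U|² ≤ C R^a` for `R ≥ 1` with `a < 3` and `U ∈ L^p`
continuous, `p > 3`, then `∫_{|y|≥L} |U|²/|y|³ ≤ C' L^{a−3}` for `L ≥ 1` (dyadic shells:
`∫_{2^kL ≤ |y| < 2^{k+1}L} |U|²/|y|³ ≤ (2^kL)^{−3} C (2^{k+1}L)^a`).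
[cite: ChaeShvydkoy2013, §3.2.1, proof of Thm. 3.2 ("splitting the integral")] -/
theorem setIntegral_normSq_div_cube_le_of_growth {p a C : ℝ} (hp : 3 < p) (hC : 0 ≤ C)
    (ha : a < 3) {U : EuclideanSpace ℝ (Fin 3) → EuclideanSpace ℝ (Fin 3)} (hUc : Continuous U)
    (hU : MemLp U (ENNReal.ofReal p) volume)
    (hG : ∀ R : ℝ, 1 ≤ R →
      ∫ y in ball (0 : EuclideanSpace ℝ (Fin 3)) R, ‖U y‖ ^ 2 ≤ C * R ^ a) :
    ∃ C' : ℝ, 0 ≤ C' ∧ ∀ L : ℝ, 1 ≤ L →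
      ∫ y in (ball (0 : EuclideanSpace ℝ (Fin 3)) L)ᶜ, ‖U y‖ ^ 2 / ‖y‖ ^ 3 ≤
        C' * L ^ (a - 3) := by
  have he : a - 3 < 0 := by linarith
  have hq1 : (2 : ℝ) ^ (a - 3) < 1 := Real.rpow_lt_one_of_one_lt_of_neg (by norm_num) he
  have hinv : 0 ≤ (1 - (2 : ℝ) ^ (a - 3))⁻¹ := inv_nonneg.2 (by linarith)
  refine ⟨C * 2 ^ a * (1 - (2 : ℝ) ^ (a - 3))⁻¹, by positivity, fun L hL => ?_⟩
  have hL0 : 0 < L := by linarith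
  have hwi : IntegrableOn (fun y => ‖U y‖ ^ 2 / ‖y‖ ^ 3)
      (ball (0 : EuclideanSpace ℝ (Fin 3)) L)ᶜ volume :=
    integrableOn_norm_sq_div_norm_cube (by linarith) hU hL0
  have key := setIntegral_compl_ball_le_of_dyadic (w := fun y => ‖U y‖ ^ 2 / ‖y‖ ^ 3)
    (C := C * 2 ^ a) (e := a - 3) hL0 he (by positivity) hwi ?_
  · calc ∫ y in (ball (0 : EuclideanSpace ℝ (Fin 3)) L)ᶜ, ‖U y‖ ^ 2 / ‖y‖ ^ 3
        ≤ C * 2 ^ a * L ^ (a - 3) * (1 - (2 : ℝ) ^ (a - 3))⁻¹ := key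
      _ = C * 2 ^ a * (1 - (2 : ℝ) ^ (a - 3))⁻¹ * L ^ (a - 3) := by ring
  intro ρ hρ
  have hρ0 : 0 < ρ := by linarith
  have hρ1 : 1 ≤ 2 * ρ := by linarith
  set A : Set (EuclideanSpace ℝ (Fin 3)) :=
    {y : EuclideanSpace ℝ (Fin 3) | ρ ≤ ‖y‖ ∧ ‖y‖ < 2 * ρ} with hA
  have hAm : MeasurableSet A :=
    (isClosed_le continuous_const continuous_norm).measurableSet.inter
      (isOpen_lt continuous_norm continuous_const).measurableSet
  have hAsub : A ⊆ ball (0 : EuclideanSpace ℝ (Fin 3)) (2 * ρ) := fun y hy => by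
    rw [mem_ball_zero_iff]
    exact hy.2
  have hAc : A ⊆ (ball (0 : EuclideanSpace ℝ (Fin 3)) L)ᶜ := fun y hy => by
    rw [mem_compl_iff, mem_ball_zero_iff, not_lt]
    exact le_trans hρ hy.1
  have hK : IsCompact (closedBall (0 : EuclideanSpace ℝ (Fin 3)) (2 * ρ)) :=
    isCompact_closedBall _ _
  have hU2 : IntegrableOn (fun y => ‖U y‖ ^ 2) (ball (0 : EuclideanSpace ℝ (Fin 3)) (2 * ρ))
      volume :=
    ((hUc.norm.pow 2).continuousOn.integrableOn_compact hK).mono_set ball_subset_closedBall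
  have h1 : ∫ y in A, ‖U y‖ ^ 2 / ‖y‖ ^ 3 ≤ ∫ y in A, ‖U y‖ ^ 2 / ρ ^ 3 := by
    refine setIntegral_mono_on (hwi.mono_set hAc) ((hU2.mono_set hAsub).div_const _) hAm
      fun y hy => ?_
    exact div_le_div_of_nonneg_left (by positivity) (pow_pos hρ0 3)
      (pow_le_pow_left₀ hρ0.le hy.1 3)
  have h2 : ∫ y in A, ‖U y‖ ^ 2 ≤ ∫ y in ball (0 : EuclideanSpace ℝ (Fin 3)) (2 * ρ), ‖U y‖ ^ 2 :=
    setIntegral_mono_set hU2 (Eventually.of_forall fun y => by positivity) hAsub.eventuallyLE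
  have h3 := hG (2 * ρ) hρ1
  calc ∫ y in A, ‖U y‖ ^ 2 / ‖y‖ ^ 3
      ≤ ∫ y in A, ‖U y‖ ^ 2 / ρ ^ 3 := h1
    _ = (∫ y in A, ‖U y‖ ^ 2) / ρ ^ 3 := integral_div _ _
    _ ≤ C * (2 * ρ) ^ a / ρ ^ 3 := by gcongr; exact h2.trans h3
    _ = C * 2 ^ a * ρ ^ (a - 3) := by
        rw [Real.mul_rpow (by norm_num) hρ0.le, Real.rpow_sub hρ0,
          show ρ ^ (3 : ℝ) = ρ ^ 3 by rw [show (3 : ℝ) = (3 : ℕ) by norm_num, Real.rpow_natCast]]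
        ring

/-- The product `|P||U|` of an `L^{p/2}` pressure (`p ≥ 2`) and a continuous field is integrable
on bounded sets. [folklore] -/
private theorem integrableOn_abs_mul_norm {p : ℝ} (hp : 2 ≤ p)
    {U : EuclideanSpace ℝ (Fin 3) → EuclideanSpace ℝ (Fin 3)} {P : EuclideanSpace ℝ (Fin 3) → ℝ}
    (hUc : Continuous U) (hP : MemLp P (ENNReal.ofReal (p / 2)) volume)
    {S : Set (EuclideanSpace ℝ (Fin 3))} (hS : Bornology.IsBounded S) :
    IntegrableOn (fun y => |P y| * ‖U y‖) S volume := by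
  obtain ⟨r, hr⟩ := hS.subset_closedBall 0
  have hK : IsCompact (closedBall (0 : EuclideanSpace ℝ (Fin 3)) r) := isCompact_closedBall _ _
  have hPloc : LocallyIntegrable P volume :=
    hP.locallyIntegrable (by
      rw [← ENNReal.ofReal_one]
      exact ENNReal.ofReal_le_ofReal (by linarith))
  have hPi : IntegrableOn (fun y => |P y|) (closedBall (0 : EuclideanSpace ℝ (Fin 3)) r) volume :=
    (hPloc.integrableOn_isCompact hK).norm
  exact (hPi.mul_continuousOn hUc.norm.continuousOn hK).mono_set hr

/-- **Lemma 3.3 with CS13's exponents (CS13 (3.5)–(3.6)).** If `∫_{|y|<R}|U|² ≤ C R^{a}` for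
`R ≥ 1` with `a ≤ 3 − 6/p` ("`a₂ ≤ N − 2N/p`"), `U ∈ L^p` continuous, `P ∈ L^{p/2}` the associated
pressure, `p > 3`, then `∫_{|y|<L}|P|^{3/2} ≤ C' L^{α_p a}` for `L ≥ 1` ("`a₃ = a₂ α_p`").
[cite: ChaeShvydkoy2013, §3.2.1 Lemma 3.3 and eqs. (3.5)–(3.6)] -/
theorem setIntegral_abs_rpow_threeHalves_le_of_growth {p a C : ℝ} (hp : 3 < p) (hC : 0 ≤ C)
    (ha : a ≤ 3 - 6 / p)
    {U : EuclideanSpace ℝ (Fin 3) → EuclideanSpace ℝ (Fin 3)} {P : EuclideanSpace ℝ (Fin 3) → ℝ}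
    (hUc : Continuous U) (hU : MemLp U (ENNReal.ofReal p) volume)
    (hP : MemLp P (ENNReal.ofReal (p / 2)) volume)
    (hPoisson : ∀ φ : EuclideanSpace ℝ (Fin 3) → ℝ, ContDiff ℝ (⊤ : ℕ∞) φ → HasCompactSupport φ →
      ∫ x, P x * (Δ φ) x = -∫ x, fderiv ℝ (fderiv ℝ φ) x (U x) (U x))
    (hG : ∀ R : ℝ, 1 ≤ R →
      ∫ y in ball (0 : EuclideanSpace ℝ (Fin 3)) R, ‖U y‖ ^ 2 ≤ C * R ^ a) :
    ∃ C' : ℝ, 0 ≤ C' ∧ ∀ L : ℝ, 1 ≤ L →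
      ∫ x in ball (0 : EuclideanSpace ℝ (Fin 3)) L, |P x| ^ (3 / 2 : ℝ) ≤
        C' * L ^ ((p - 3) / (p - 2) * a) := by
  have hp0 : 0 < p := by linarith
  have hp2 : 0 < p - 2 := by linarith
  have ha3 : a < 3 := by
    have : 0 < 6 / p := by positivity
    linarith
  set κ : ℝ := (p - 3) / (p - 2) with hκ
  have hκ0 : 0 ≤ κ := div_nonneg (by linarith) hp2.le
  -- the exponent comparison `(3a − 3)/2 ≤ α_p a`, i.e. `a ≤ 3 − 6/p`
  have hexp : 3 + (a - 3) * (3 / 2) ≤ κ * a := by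
    have hap : a * p ≤ 3 * p - 6 := by
      have := mul_le_mul_of_nonneg_right ha hp0.le
      rwa [sub_mul, div_mul_cancel₀ _ hp0.ne'] at this
    rw [hκ, div_mul_eq_mul_div, le_div_iff₀ hp2]
    nlinarith
  obtain ⟨A, B, hA0, hB0, hAB⟩ := exists_setIntegral_abs_rpow_threeHalves_le
  obtain ⟨C₃, hC₃0, hC₃⟩ := setIntegral_norm_cube_le_of_growth hp hC hUc hU hG
  obtain ⟨C_W, hCW0, hCW⟩ := setIntegral_normSq_div_cube_le_of_growth hp hC ha3 hUc hU hG
  refine ⟨A * C₃ * 2 ^ (κ * a) + B * (C_W ^ (3 / 2 : ℝ) * 2 ^ ((a - 3) * (3 / 2))),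
    by positivity, fun L hL => ?_⟩
  have hL0 : 0 < L := by linarith
  have h2L : 1 ≤ 2 * L := by linarith
  have h2L0 : 0 ≤ 2 * L := by linarith
  have hmain := hAB hp.le hUc hU hP hPoisson hL0
  -- the near term
  have e3 : ∀ y : EuclideanSpace ℝ (Fin 3), ‖U y‖ ^ (3 : ℝ) = ‖U y‖ ^ 3 := fun y => by
    rw [show (3 : ℝ) = (3 : ℕ) by norm_num, Real.rpow_natCast]
  have hnear : ∫ y in ball (0 : EuclideanSpace ℝ (Fin 3)) (2 * L), ‖U y‖ ^ (3 : ℝ) ≤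
      C₃ * 2 ^ (κ * a) * L ^ (κ * a) := by
    simp only [e3]
    refine (hC₃ (2 * L) h2L).trans (le_of_eq ?_)
    rw [Real.mul_rpow (by norm_num) hL0.le]
    ring
  -- the far term
  have hW0 : 0 ≤ ∫ y in (ball (0 : EuclideanSpace ℝ (Fin 3)) (2 * L))ᶜ, ‖U y‖ ^ 2 / ‖y‖ ^ 3 :=
    integral_nonneg fun y => by positivity
  have hfar : L ^ 3 * (∫ y in (ball (0 : EuclideanSpace ℝ (Fin 3)) (2 * L))ᶜ,
      ‖U y‖ ^ 2 / ‖y‖ ^ 3) ^ (3 / 2 : ℝ) ≤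
      C_W ^ (3 / 2 : ℝ) * 2 ^ ((a - 3) * (3 / 2)) * L ^ (κ * a) := by
    have h1 : (∫ y in (ball (0 : EuclideanSpace ℝ (Fin 3)) (2 * L))ᶜ, ‖U y‖ ^ 2 / ‖y‖ ^ 3) ^
        (3 / 2 : ℝ) ≤ (C_W * (2 * L) ^ (a - 3)) ^ (3 / 2 : ℝ) :=
      Real.rpow_le_rpow hW0 (hCW (2 * L) h2L) (by norm_num)
    have h2 : (C_W * (2 * L) ^ (a - 3)) ^ (3 / 2 : ℝ) =
        C_W ^ (3 / 2 : ℝ) * 2 ^ ((a - 3) * (3 / 2)) * L ^ ((a - 3) * (3 / 2)) := by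
      rw [Real.mul_rpow hCW0 (Real.rpow_nonneg h2L0 _), ← Real.rpow_mul h2L0,
        Real.mul_rpow (by norm_num) hL0.le]
      ring
    have h3 : L ^ 3 * L ^ ((a - 3) * (3 / 2)) ≤ L ^ (κ * a) := by
      rw [show L ^ 3 = L ^ (3 : ℝ) by rw [show (3 : ℝ) = (3 : ℕ) by norm_num, Real.rpow_natCast],
        ← Real.rpow_add hL0]
      exact Real.rpow_le_rpow_of_exponent_le hL hexp
    calc L ^ 3 * (∫ y in (ball (0 : EuclideanSpace ℝ (Fin 3)) (2 * L))ᶜ,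
          ‖U y‖ ^ 2 / ‖y‖ ^ 3) ^ (3 / 2 : ℝ)
        ≤ L ^ 3 * (C_W ^ (3 / 2 : ℝ) * 2 ^ ((a - 3) * (3 / 2)) * L ^ ((a - 3) * (3 / 2))) := by
          rw [← h2]
          exact mul_le_mul_of_nonneg_left h1 (by positivity)
      _ = C_W ^ (3 / 2 : ℝ) * 2 ^ ((a - 3) * (3 / 2)) * (L ^ 3 * L ^ ((a - 3) * (3 / 2))) := by
          ring
      _ ≤ C_W ^ (3 / 2 : ℝ) * 2 ^ ((a - 3) * (3 / 2)) * L ^ (κ * a) :=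
          mul_le_mul_of_nonneg_left h3 (by positivity)
  calc ∫ x in ball (0 : EuclideanSpace ℝ (Fin 3)) L, |P x| ^ (3 / 2 : ℝ)
      ≤ A * (∫ y in ball (0 : EuclideanSpace ℝ (Fin 3)) (2 * L), ‖U y‖ ^ (3 : ℝ)) +
          B * L ^ 3 * (∫ y in (ball (0 : EuclideanSpace ℝ (Fin 3)) (2 * L))ᶜ,
            ‖U y‖ ^ 2 / ‖y‖ ^ 3) ^ (3 / 2 : ℝ) := hmain
    _ ≤ A * (C₃ * 2 ^ (κ * a) * L ^ (κ * a)) +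
          B * (C_W ^ (3 / 2 : ℝ) * 2 ^ ((a - 3) * (3 / 2)) * L ^ (κ * a)) := by
        rw [mul_assoc B]
        exact add_le_add (mul_le_mul_of_nonneg_left hnear hA0)
          (mul_le_mul_of_nonneg_left hfar hB0)
    _ = (A * C₃ * 2 ^ (κ * a) + B * (C_W ^ (3 / 2 : ℝ) * 2 ^ ((a - 3) * (3 / 2)))) *
          L ^ (κ * a) := by ring

/-- **The local flux from growth.** Under the hypotheses of
`setIntegral_abs_rpow_threeHalves_le_of_growth`: `∫_{|y|≤R} (|U|³ + 2|P||U|) ≤ C' R^{α_p a}` for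
`R ≥ 1` (Hölder `(3/2, 3)` for the pressure term, CS13 "`∫|q||v| ≤ C(L^{a₃})^{2/3}(L^{a₁})^{1/3}`").
[cite: ChaeShvydkoy2013, §3.2.1, display after (3.6)] -/
theorem setIntegral_flux_le_of_growth {p a C : ℝ} (hp : 3 < p) (hC : 0 ≤ C)
    (ha : a ≤ 3 - 6 / p)
    {U : EuclideanSpace ℝ (Fin 3) → EuclideanSpace ℝ (Fin 3)} {P : EuclideanSpace ℝ (Fin 3) → ℝ}
    (hUc : Continuous U) (hU : MemLp U (ENNReal.ofReal p) volume)
    (hP : MemLp P (ENNReal.ofReal (p / 2)) volume)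
    (hPoisson : ∀ φ : EuclideanSpace ℝ (Fin 3) → ℝ, ContDiff ℝ (⊤ : ℕ∞) φ → HasCompactSupport φ →
      ∫ x, P x * (Δ φ) x = -∫ x, fderiv ℝ (fderiv ℝ φ) x (U x) (U x))
    (hG : ∀ R : ℝ, 1 ≤ R →
      ∫ y in ball (0 : EuclideanSpace ℝ (Fin 3)) R, ‖U y‖ ^ 2 ≤ C * R ^ a) :
    ∃ C' : ℝ, 0 ≤ C' ∧ ∀ R : ℝ, 1 ≤ R →
      ∫ y in closedBall (0 : EuclideanSpace ℝ (Fin 3)) R, (‖U y‖ ^ 3 + 2 * (|P y| * ‖U y‖)) ≤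
        C' * R ^ ((p - 3) / (p - 2) * a) := by
  have hp2 : 0 < p - 2 := by linarith
  set κ : ℝ := (p - 3) / (p - 2) with hκ
  obtain ⟨C₃, hC₃0, hC₃⟩ := setIntegral_norm_cube_le_of_growth hp hC hUc hU hG
  obtain ⟨C_P, hCP0, hCP⟩ :=
    setIntegral_abs_rpow_threeHalves_le_of_growth hp hC ha hUc hU hP hPoisson hG
  refine ⟨(C₃ + 2 * (C_P ^ (2 / 3 : ℝ) * C₃ ^ (1 / 3 : ℝ))) * 2 ^ (κ * a), by positivity,
    fun R hR => ?_⟩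
  have hR0 : 0 < R := by linarith
  have h2R : 1 ≤ 2 * R := by linarith
  have h2R0 : 0 < 2 * R := by linarith
  set X : ℝ := (2 * R) ^ (κ * a) with hX
  have hX0 : 0 < X := Real.rpow_pos_of_pos h2R0 _
  have hXR : X = 2 ^ (κ * a) * R ^ (κ * a) := by rw [hX, Real.mul_rpow (by norm_num) hR0.le]
  have hsub : closedBall (0 : EuclideanSpace ℝ (Fin 3)) R ⊆
      ball (0 : EuclideanSpace ℝ (Fin 3)) (2 * R) := closedBall_subset_ball (by linarith)
  have hbdd : Bornology.IsBounded (closedBall (0 : EuclideanSpace ℝ (Fin 3)) R) :=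
    isBounded_closedBall
  have hK2 : IsCompact (closedBall (0 : EuclideanSpace ℝ (Fin 3)) (2 * R)) :=
    isCompact_closedBall _ _
  -- integrability of the pieces
  have hU3i : IntegrableOn (fun y => ‖U y‖ ^ 3) (ball (0 : EuclideanSpace ℝ (Fin 3)) (2 * R))
      volume :=
    ((hUc.norm.pow 3).continuousOn.integrableOn_compact hK2).mono_set ball_subset_closedBall
  have hPUi : IntegrableOn (fun y => |P y| * ‖U y‖) (closedBall (0 : EuclideanSpace ℝ (Fin 3)) R)
      volume := integrableOn_abs_mul_norm (by linarith) hUc hP hbdd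
  have hP32i : IntegrableOn (fun y => |P y| ^ (3 / 2 : ℝ))
      (ball (0 : EuclideanSpace ℝ (Fin 3)) (2 * R)) volume := by
    have h1 : MemLp P (ENNReal.ofReal (3 / 2))
        (volume.restrict (ball (0 : EuclideanSpace ℝ (Fin 3)) (2 * R))) := by
      haveI : IsFiniteMeasure (volume.restrict (ball (0 : EuclideanSpace ℝ (Fin 3)) (2 * R))) :=
        isFiniteMeasure_restrict.2 measure_ball_lt_top.ne
      exact (hP.restrict _).mono_exponent (ENNReal.ofReal_le_ofReal (by linarith))
    have h2 := h1.integrable_norm_rpow (by norm_num) ENNReal.ofReal_ne_top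
    rw [ENNReal.toReal_ofReal (by norm_num)] at h2
    simpa [IntegrableOn, Real.norm_eq_abs] using h2
  -- the cube term
  have I1 : ∫ y in closedBall (0 : EuclideanSpace ℝ (Fin 3)) R, ‖U y‖ ^ 3 ≤ C₃ * X :=
    (setIntegral_mono_set hU3i (Eventually.of_forall fun y => by positivity)
      hsub.eventuallyLE).trans (hC₃ (2 * R) h2R)
  -- the pressure term by Hölder
  have I2 : ∫ y in closedBall (0 : EuclideanSpace ℝ (Fin 3)) R, |P y| * ‖U y‖ ≤
      C_P ^ (2 / 3 : ℝ) * C₃ ^ (1 / 3 : ℝ) * X := by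
    have hH := setIntegral_abs_mul_norm_le hp.le hUc hP hbdd
    have e3 : ∀ y : EuclideanSpace ℝ (Fin 3), ‖U y‖ ^ (3 : ℝ) = ‖U y‖ ^ 3 := fun y => by
      rw [show (3 : ℝ) = (3 : ℕ) by norm_num, Real.rpow_natCast]
    simp only [e3, show (1 / (3 / 2) : ℝ) = 2 / 3 by norm_num] at hH
    have hA : (∫ y in closedBall (0 : EuclideanSpace ℝ (Fin 3)) R, |P y| ^ (3 / 2 : ℝ)) ≤ C_P * X :=
      (setIntegral_mono_set hP32i (Eventually.of_forall fun y => by positivity)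
        hsub.eventuallyLE).trans (hCP (2 * R) h2R)
    have hB : (∫ y in closedBall (0 : EuclideanSpace ℝ (Fin 3)) R, ‖U y‖ ^ 3) ≤ C₃ * X := I1
    have hA0 : 0 ≤ ∫ y in closedBall (0 : EuclideanSpace ℝ (Fin 3)) R, |P y| ^ (3 / 2 : ℝ) :=
      integral_nonneg fun y => by positivity
    have hB0 : 0 ≤ ∫ y in closedBall (0 : EuclideanSpace ℝ (Fin 3)) R, ‖U y‖ ^ 3 :=
      integral_nonneg fun y => by positivity
    refine hH.trans ?_
    calc (∫ y in closedBall (0 : EuclideanSpace ℝ (Fin 3)) R, |P y| ^ (3 / 2 : ℝ)) ^ (2 / 3 : ℝ) *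
          (∫ y in closedBall (0 : EuclideanSpace ℝ (Fin 3)) R, ‖U y‖ ^ 3) ^ (1 / 3 : ℝ)
        ≤ (C_P * X) ^ (2 / 3 : ℝ) * (C₃ * X) ^ (1 / 3 : ℝ) :=
          mul_le_mul (Real.rpow_le_rpow hA0 hA (by norm_num))
            (Real.rpow_le_rpow hB0 hB (by norm_num)) (Real.rpow_nonneg hB0 _)
            (Real.rpow_nonneg (by positivity) _)
      _ = C_P ^ (2 / 3 : ℝ) * C₃ ^ (1 / 3 : ℝ) * (X ^ (2 / 3 : ℝ) * X ^ (1 / 3 : ℝ)) := by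
          rw [Real.mul_rpow hCP0 hX0.le, Real.mul_rpow hC₃0 hX0.le]
          ring
      _ = C_P ^ (2 / 3 : ℝ) * C₃ ^ (1 / 3 : ℝ) * X := by
          rw [← Real.rpow_add hX0, show (2 / 3 + 1 / 3 : ℝ) = 1 by norm_num, Real.rpow_one]
  rw [integral_add (hU3i.mono_set hsub) (hPUi.const_mul 2), integral_const_mul]
  calc (∫ y in closedBall (0 : EuclideanSpace ℝ (Fin 3)) R, ‖U y‖ ^ 3) +
        2 * ∫ y in closedBall (0 : EuclideanSpace ℝ (Fin 3)) R, |P y| * ‖U y‖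
      ≤ C₃ * X + 2 * (C_P ^ (2 / 3 : ℝ) * C₃ ^ (1 / 3 : ℝ) * X) := by
        gcongr
    _ = (C₃ + 2 * (C_P ^ (2 / 3 : ℝ) * C₃ ^ (1 / 3 : ℝ))) * 2 ^ (κ * a) * R ^ (κ * a) := by
        rw [hXR]
        ring

/-! ## One round of the bootstrap (CS13 (3.7) and "and so on") -/

/-- **Bootstrap round, range `−1 < α ≤ 3/p`.** If `∫_{|y|<R}|U|² ≤ C R^a` for `R ≥ 1` with
`0 ≤ a ≤ 3 − 6/p`, then `∫_{|y|<R}|U|² ≤ C' R^{α_p a − 1}` for `R ≥ 1`: CS13 (3.2) with the local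
flux bound `∫_{|y|≤ρ}(|U|³ + 2|P||U|) ≲ ρ^{α_p a}` summed over dyadic shells
("`Σ_k 2^{k(β_pα_p − N − 1 + 2α)} l^{β_pα_p − N − 1 + 2α}` … `∫_{|y|≤l}|v|² ≤ C₃ l^{β_pα_p − 1}`").
[cite: ChaeShvydkoy2013, §3.2.1 eqs. (3.2), (3.7)] -/
theorem IsSelfSimilarEulerProfile.energyGrowth_step_of_le {α p a C : ℝ}
    {U : EuclideanSpace ℝ (Fin 3) → EuclideanSpace ℝ (Fin 3)} {P : EuclideanSpace ℝ (Fin 3) → ℝ}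
    (h : IsSelfSimilarEulerProfile (1 / (α + 1)) 0 U P) (hα : -1 < α) (hp : 3 < p)
    (hαp : α ≤ 3 / p) (hU : MemLp U (ENNReal.ofReal p) volume)
    (hP : MemLp P (ENNReal.ofReal (p / 2)) volume)
    (hPoisson : ∀ φ : EuclideanSpace ℝ (Fin 3) → ℝ, ContDiff ℝ (⊤ : ℕ∞) φ → HasCompactSupport φ →
      ∫ x, P x * (Δ φ) x = -∫ x, fderiv ℝ (fderiv ℝ φ) x (U x) (U x))
    (hC : 0 ≤ C) (ha0 : 0 ≤ a) (ha : a ≤ 3 - 6 / p)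
    (hG : ∀ R : ℝ, 1 ≤ R →
      ∫ y in ball (0 : EuclideanSpace ℝ (Fin 3)) R, ‖U y‖ ^ 2 ≤ C * R ^ a) :
    ∃ C' : ℝ, 0 ≤ C' ∧ ∀ R : ℝ, 1 ≤ R →
      ∫ y in ball (0 : EuclideanSpace ℝ (Fin 3)) R, ‖U y‖ ^ 2 ≤
        C' * R ^ ((p - 3) / (p - 2) * a - 1) := by
  have hp0 : 0 < p := by linarith
  have hp2 : 0 < p - 2 := by linarith
  have hp3 : 0 < p - 3 := by linarith
  have hαp' : α * p ≤ 3 := by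
    have := mul_le_mul_of_nonneg_right hαp hp0.le
    rwa [div_mul_cancel₀ _ hp0.ne'] at this
  have h6 : 2 * α ≤ 6 / p := by
    rw [le_div_iff₀ hp0]
    linarith
  have hα1 : α < 1 := by
    have : 3 / p < 1 := by rw [div_lt_one hp0]; linarith
    linarith
  have hα3 : 0 < 3 - 2 * α := by linarith
  have hUc : Continuous U := h.contDiff_velocity.continuous
  set κ : ℝ := (p - 3) / (p - 2) with hκ
  have hκ0 : 0 ≤ κ := div_nonneg hp3.le hp2.le
  have hκ1 : κ ≤ 1 := by
    rw [hκ, div_le_one hp2]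
    linarith
  have hκa : κ * a ≤ a := by nlinarith
  obtain ⟨K, hK0, hK⟩ := h.ball_energy_le_weightedFlux hα hp hαp hU hP
  obtain ⟨C_f, hCf0, hCf⟩ := setIntegral_flux_le_of_growth hp hC ha hUc hU hP hPoisson hG
  set f : EuclideanSpace ℝ (Fin 3) → ℝ := fun y => ‖U y‖ ^ 3 + 2 * (|P y| * ‖U y‖) with hf_def
  have hf0 : ∀ y, 0 ≤ f y := fun y => by positivity
  have hfLp : MemLp f (ENNReal.ofReal (p / 3)) volume := memLp_flux_of_memLp hp hU hP
  -- the weight exponent and the Hölder admissibility of `|y|^{2α−4}` against `f ∈ L^{p/3}`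
  have hm : 3 < (4 - 2 * α) * (p / (p - 3)) := by
    rw [← mul_div_assoc, lt_div_iff₀ hp3]
    nlinarith
  -- the decay exponent of the weighted shells
  set e : ℝ := κ * a + (2 * α - 4) with he_def
  have he : e < 0 := by
    rw [he_def]
    linarith
  have hq1 : (2 : ℝ) ^ e < 1 := Real.rpow_lt_one_of_one_lt_of_neg (by norm_num) he
  have hinv : 0 ≤ (1 - (2 : ℝ) ^ e)⁻¹ := inv_nonneg.2 (by linarith)
  refine ⟨K * (C_f * 2 ^ (κ * a)) * (1 - (2 : ℝ) ^ e)⁻¹ / (3 - 2 * α), by positivity,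
    fun R hR => ?_⟩
  have hR0 : 0 < R := by linarith
  -- integrability of the weighted flux outside `B_R`
  have hwi : IntegrableOn (fun y : EuclideanSpace ℝ (Fin 3) => ‖y‖ ^ (2 * α - 4) * f y)
      (ball (0 : EuclideanSpace ℝ (Fin 3)) R)ᶜ volume := by
    have h1 := (setIntegral_weight_mul_flux_le hp hm hR0 hf0 hfLp).1
    rw [show -(4 - 2 * α) = 2 * α - 4 by ring] at h1
    exact h1
  -- the shell bounds
  have hann : ∀ ρ : ℝ, R ≤ ρ →
      ∫ y in {y : EuclideanSpace ℝ (Fin 3) | ρ ≤ ‖y‖ ∧ ‖y‖ < 2 * ρ}, ‖y‖ ^ (2 * α - 4) * f y ≤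
        C_f * 2 ^ (κ * a) * ρ ^ e := by
    intro ρ hρ
    have hρ0 : 0 < ρ := by linarith
    have hρ1 : 1 ≤ 2 * ρ := by linarith
    set A : Set (EuclideanSpace ℝ (Fin 3)) :=
      {y : EuclideanSpace ℝ (Fin 3) | ρ ≤ ‖y‖ ∧ ‖y‖ < 2 * ρ} with hA
    have hAm : MeasurableSet A :=
      (isClosed_le continuous_const continuous_norm).measurableSet.inter
        (isOpen_lt continuous_norm continuous_const).measurableSet
    have hAsub : A ⊆ closedBall (0 : EuclideanSpace ℝ (Fin 3)) (2 * ρ) := fun y hy => by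
      rw [mem_closedBall_zero_iff]
      exact hy.2.le
    have hAc : A ⊆ (ball (0 : EuclideanSpace ℝ (Fin 3)) R)ᶜ := fun y hy => by
      rw [mem_compl_iff, mem_ball_zero_iff, not_lt]
      exact le_trans hρ hy.1
    have hbdd : Bornology.IsBounded (closedBall (0 : EuclideanSpace ℝ (Fin 3)) (2 * ρ)) :=
      isBounded_closedBall
    have hfi : IntegrableOn f (closedBall (0 : EuclideanSpace ℝ (Fin 3)) (2 * ρ)) volume :=
      (((hUc.norm.pow 3).continuousOn.integrableOn_compact (isCompact_closedBall _ _)).add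
        ((integrableOn_abs_mul_norm (by linarith) hUc hP hbdd).const_mul 2))
    have h1 : ∫ y in A, ‖y‖ ^ (2 * α - 4) * f y ≤ ∫ y in A, ρ ^ (2 * α - 4) * f y := by
      refine setIntegral_mono_on (hwi.mono_set hAc) ((hfi.mono_set hAsub).const_mul _) hAm
        fun y hy => ?_
      exact mul_le_mul_of_nonneg_right
        (Real.rpow_le_rpow_of_nonpos hρ0 hy.1 (by linarith)) (hf0 y)
    have h2 : ∫ y in A, f y ≤ ∫ y in closedBall (0 : EuclideanSpace ℝ (Fin 3)) (2 * ρ), f y :=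
      setIntegral_mono_set hfi (Eventually.of_forall hf0) hAsub.eventuallyLE
    have h3 := hCf (2 * ρ) hρ1
    calc ∫ y in A, ‖y‖ ^ (2 * α - 4) * f y
        ≤ ∫ y in A, ρ ^ (2 * α - 4) * f y := h1
      _ = ρ ^ (2 * α - 4) * ∫ y in A, f y := integral_const_mul _ _
      _ ≤ ρ ^ (2 * α - 4) * (C_f * (2 * ρ) ^ (κ * a)) :=
          mul_le_mul_of_nonneg_left (h2.trans h3) (Real.rpow_nonneg hρ0.le _)
      _ = C_f * 2 ^ (κ * a) * ρ ^ e := by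
          rw [Real.mul_rpow (by norm_num) hρ0.le, he_def, Real.rpow_add hρ0]
          ring
  have htail := setIntegral_compl_ball_le_of_dyadic hR0 he (by positivity) hwi hann
  have hmain := hK R hR0
  have hpow : R ^ (3 - 2 * α) * R ^ e = R ^ (κ * a - 1) := by
    rw [← Real.rpow_add hR0, he_def]
    ring_nf
  rw [div_mul_eq_mul_div, le_div_iff₀ hα3]
  calc (∫ y in ball (0 : EuclideanSpace ℝ (Fin 3)) R, ‖U y‖ ^ 2) * (3 - 2 * α)
      = (3 - 2 * α) * ∫ y in ball (0 : EuclideanSpace ℝ (Fin 3)) R, ‖U y‖ ^ 2 := mul_comm _ _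
    _ ≤ K * R ^ (3 - 2 * α) * ∫ y in (ball (0 : EuclideanSpace ℝ (Fin 3)) R)ᶜ,
          ‖y‖ ^ (2 * α - 4) * f y := hmain
    _ ≤ K * R ^ (3 - 2 * α) * (C_f * 2 ^ (κ * a) * R ^ e * (1 - (2 : ℝ) ^ e)⁻¹) :=
        mul_le_mul_of_nonneg_left htail (by positivity)
    _ = K * (C_f * 2 ^ (κ * a)) * (1 - (2 : ℝ) ^ e)⁻¹ * (R ^ (3 - 2 * α) * R ^ e) := by ring
    _ = K * (C_f * 2 ^ (κ * a)) * (1 - (2 : ℝ) ^ e)⁻¹ * R ^ (κ * a - 1) := by rw [hpow]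

/-- **Bootstrap round, range `α > 3/2`.** If `∫_{|y|<R}|U|² ≤ C R^a` for `R ≥ 1` with
`a ≤ 3 − 6/p`, then `∫_{|y|<R}|U|² ≤ C' R^{α_p a − 1}` for `R ≥ 1`: CS13 (3.9) (single cut-off
`σ(·/L)`: `(2α − N)∫_{|y|<L/2}|v|² ≤ (K/L)∫_{|y|≤L}(|v|³ + 2|q||v|)`) with the local flux bound
`≲ L^{α_p a}`; this is the recursion behind CS13 (3.10)–(3.11) (`(N+1−2α) + (α_pγ_p − N − 2 + 2α)
= α_pγ_p − 1`). [cite: ChaeShvydkoy2013, §3.2.2 eqs. (3.9)–(3.11)] -/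
theorem IsSelfSimilarEulerProfile.energyGrowth_step_of_gt_three_halves {α p a C : ℝ}
    {U : EuclideanSpace ℝ (Fin 3) → EuclideanSpace ℝ (Fin 3)} {P : EuclideanSpace ℝ (Fin 3) → ℝ}
    (h : IsSelfSimilarEulerProfile (1 / (α + 1)) 0 U P) (hα : 3 / 2 < α) (hp : 3 < p)
    (hU : MemLp U (ENNReal.ofReal p) volume) (hP : MemLp P (ENNReal.ofReal (p / 2)) volume)
    (hPoisson : ∀ φ : EuclideanSpace ℝ (Fin 3) → ℝ, ContDiff ℝ (⊤ : ℕ∞) φ → HasCompactSupport φ →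
      ∫ x, P x * (Δ φ) x = -∫ x, fderiv ℝ (fderiv ℝ φ) x (U x) (U x))
    (hC : 0 ≤ C) (ha : a ≤ 3 - 6 / p)
    (hG : ∀ R : ℝ, 1 ≤ R →
      ∫ y in ball (0 : EuclideanSpace ℝ (Fin 3)) R, ‖U y‖ ^ 2 ≤ C * R ^ a) :
    ∃ C' : ℝ, 0 ≤ C' ∧ ∀ R : ℝ, 1 ≤ R →
      ∫ y in ball (0 : EuclideanSpace ℝ (Fin 3)) R, ‖U y‖ ^ 2 ≤
        C' * R ^ ((p - 3) / (p - 2) * a - 1) := by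
  have hp2 : 0 < p - 2 := by linarith
  have hα3 : 0 < 2 * α - 3 := by linarith
  have hUc : Continuous U := h.contDiff_velocity.continuous
  set κ : ℝ := (p - 3) / (p - 2) with hκ
  have hPloc : LocallyIntegrable P volume :=
    hP.locallyIntegrable (by
      rw [← ENNReal.ofReal_one]
      exact ENNReal.ofReal_le_ofReal (by linarith))
  obtain ⟨K, hK0, hK⟩ := h.ball_energy_le_localFlux hα hPloc
  obtain ⟨C_f, hCf0, hCf⟩ := setIntegral_flux_le_of_growth hp hC ha hUc hU hP hPoisson hG
  refine ⟨K * C_f * 2 ^ (κ * a - 1) / (2 * α - 3), by positivity, fun R hR => ?_⟩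
  have hR0 : 0 < R := by linarith
  have h2R : 1 ≤ 2 * R := by linarith
  have h2R0 : 0 < 2 * R := by linarith
  have hmain := hK (2 * R) h2R0
  rw [show 2 * R / 2 = R by ring] at hmain
  have hflux := hCf (2 * R) h2R
  rw [div_mul_eq_mul_div, le_div_iff₀ hα3]
  calc (∫ y in ball (0 : EuclideanSpace ℝ (Fin 3)) R, ‖U y‖ ^ 2) * (2 * α - 3)
      = (2 * α - 3) * ∫ y in ball (0 : EuclideanSpace ℝ (Fin 3)) R, ‖U y‖ ^ 2 := mul_comm _ _
    _ ≤ K / (2 * R) * ∫ y in closedBall (0 : EuclideanSpace ℝ (Fin 3)) (2 * R),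
          (‖U y‖ ^ 3 + 2 * (|P y| * ‖U y‖)) := hmain
    _ ≤ K / (2 * R) * (C_f * (2 * R) ^ (κ * a)) :=
        mul_le_mul_of_nonneg_left hflux (by positivity)
    _ = K * C_f * ((2 * R) ^ (κ * a) / (2 * R)) := by ring
    _ = K * C_f * 2 ^ (κ * a - 1) * R ^ (κ * a - 1) := by
        rw [← Real.rpow_sub_one h2R0.ne', Real.mul_rpow (by norm_num) hR0.le]
        ring

/-- **One bootstrap round in either range of Theorem 3.2.**
[cite: ChaeShvydkoy2013, §3.2.1–3.2.2, proof of Thm. 3.2] -/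
theorem IsSelfSimilarEulerProfile.energyGrowth_step {α p a C : ℝ}
    {U : EuclideanSpace ℝ (Fin 3) → EuclideanSpace ℝ (Fin 3)} {P : EuclideanSpace ℝ (Fin 3) → ℝ}
    (h : IsSelfSimilarEulerProfile (1 / (α + 1)) 0 U P) (hα : -1 < α) (hp : 3 < p)
    (hrange : α ≤ 3 / p ∨ 3 / 2 < α) (hU : MemLp U (ENNReal.ofReal p) volume)
    (hP : MemLp P (ENNReal.ofReal (p / 2)) volume)
    (hPoisson : ∀ φ : EuclideanSpace ℝ (Fin 3) → ℝ, ContDiff ℝ (⊤ : ℕ∞) φ → HasCompactSupport φ →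
      ∫ x, P x * (Δ φ) x = -∫ x, fderiv ℝ (fderiv ℝ φ) x (U x) (U x))
    (hC : 0 ≤ C) (ha0 : 0 ≤ a) (ha : a ≤ 3 - 6 / p)
    (hG : ∀ R : ℝ, 1 ≤ R →
      ∫ y in ball (0 : EuclideanSpace ℝ (Fin 3)) R, ‖U y‖ ^ 2 ≤ C * R ^ a) :
    ∃ C' : ℝ, 0 ≤ C' ∧ ∀ R : ℝ, 1 ≤ R →
      ∫ y in ball (0 : EuclideanSpace ℝ (Fin 3)) R, ‖U y‖ ^ 2 ≤
        C' * R ^ ((p - 3) / (p - 2) * a - 1) := by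
  rcases hrange with h1 | h2
  · exact h.energyGrowth_step_of_le hα hp h1 hU hP hPoisson hC ha0 ha hG
  · exact h.energyGrowth_step_of_gt_three_halves h2 hp hU hP hPoisson hC ha hG

/-! ## Finitely many rounds, and Theorem 3.2 -/

/-- The exponent recursion `e₀ = β`, `e_{n+1} = κ e_n − 1` with `κ ≤ 1` reaches a negative value
("For `n` sufficiently large the power `β_pα_pⁿ − α_p^{n−1} − … − 1` will become negative").
[folklore] -/
private theorem exists_iterate_neg (β κ : ℝ) (hκ : κ ≤ 1) :
    ∃ n : ℕ, (fun x : ℝ => κ * x - 1)^[n] β < 0 := by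
  by_contra hcon
  push Not at hcon
  have hle : ∀ n : ℕ, (fun x : ℝ => κ * x - 1)^[n] β ≤ β - n := by
    intro n
    induction n with
    | zero => simp
    | succ n ih =>
      rw [Function.iterate_succ_apply']
      have h0 := hcon n
      push_cast
      nlinarith
  obtain ⟨n, hn⟩ := exists_nat_gt β
  have h1 := hle n
  have h2 := hcon n
  linarith

/-- **Chae–Shvydkoy 2013, Theorem 3.2, `3 < p < ∞`, both ranges.** A stationary self-similar
Euler profile with exponent `γ = 1/(α+1)`, `U ∈ L^p(ℝ³)` (`C¹`, hence continuous), associated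
pressure `P ∈ L^{p/2}` (weak Poisson equation `−ΔP = ∂_i∂_j(U_iU_j)`), and `−1 < α ≤ 3/p` or
`α > 3/2`, is trivial: the first growth bound `β_p = 2 − 9/p` (CS13 (3.3)) is improved by the
recursion `a ↦ α_p a − 1` (`energyGrowth_step`) finitely many times until the exponent is
negative, and a negative growth exponent forces `U = 0`
(`eq_zero_of_energyGrowth_of_three_halves_lt`). [cite: ChaeShvydkoy2013, §3.2 Thm. 3.2] -/
theorem IsSelfSimilarEulerProfile.eq_zero_of_memLp {α p : ℝ}
    {U : EuclideanSpace ℝ (Fin 3) → EuclideanSpace ℝ (Fin 3)} {P : EuclideanSpace ℝ (Fin 3) → ℝ}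
    (h : IsSelfSimilarEulerProfile (1 / (α + 1)) 0 U P) (hα : -1 < α) (hp : 3 < p)
    (hrange : α ≤ 3 / p ∨ 3 / 2 < α) (hU : MemLp U (ENNReal.ofReal p) volume)
    (hP : MemLp P (ENNReal.ofReal (p / 2)) volume)
    (hPoisson : ∀ φ : EuclideanSpace ℝ (Fin 3) → ℝ, ContDiff ℝ (⊤ : ℕ∞) φ → HasCompactSupport φ →
      ∫ x, P x * (Δ φ) x = -∫ x, fderiv ℝ (fderiv ℝ φ) x (U x) (U x)) :
    U = 0 := by
  have hp0 : 0 < p := by linarith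
  have hp2 : 0 < p - 2 := by linarith
  have hUc : Continuous U := h.contDiff_velocity.continuous
  set κ : ℝ := (p - 3) / (p - 2) with hκ
  have hκ1 : κ ≤ 1 := by
    rw [hκ, div_le_one hp2]
    linarith
  set β : ℝ := 2 - 9 / p with hβ
  have hβ3 : β ≤ 3 - 6 / p := by
    rw [hβ]
    have : 0 < 3 / p := by positivity
    have e : (9 : ℝ) / p = 6 / p + 3 / p := by ring
    linarith
  -- the exponent sequence
  set e : ℕ → ℝ := fun n => (fun x : ℝ => κ * x - 1)^[n] β with he_def
  have he0 : e 0 = β := by simp [he_def]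
  have hesucc : ∀ n, e (n + 1) = κ * e n - 1 := fun n => by
    simp only [he_def]
    rw [Function.iterate_succ_apply']
  -- the first negative exponent
  have hex : ∃ n, e n < 0 := exists_iterate_neg β κ hκ1
  classical
  set N : ℕ := Nat.find hex with hN
  have hNneg : e N < 0 := Nat.find_spec hex
  have hbefore : ∀ k, k < N → 0 ≤ e k := fun k hk => not_lt.1 (Nat.find_min hex hk)
  -- while nonnegative, the exponents stay below `β ≤ 3 − 6/p`
  have hmono : ∀ k, k ≤ N → e k ≤ β := by
    intro k
    induction k with
    | zero => intro; rw [he0]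
    | succ k ih =>
      intro hk
      have hk' : k < N := Nat.lt_of_succ_le hk
      have h0 := hbefore k hk'
      have h1 := ih hk'.le
      rw [hesucc]
      nlinarith
  -- growth with exponent `e k` for every `k ≤ N`
  have hgrowth : ∀ k, k ≤ N → ∃ C : ℝ, 0 ≤ C ∧ ∀ R : ℝ, 1 ≤ R →
      ∫ y in ball (0 : EuclideanSpace ℝ (Fin 3)) R, ‖U y‖ ^ 2 ≤ C * R ^ (e k) := by
    intro k
    induction k with
    | zero =>
      intro
      obtain ⟨C, hC0, hC⟩ : ∃ C : ℝ, 0 ≤ C ∧ ∀ L : ℝ, 0 < L →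
          ∫ y in ball (0 : EuclideanSpace ℝ (Fin 3)) L, ‖U y‖ ^ 2 ≤ C * L ^ (2 - 9 / p) := by
        rcases hrange with h1 | h2
        · exact h.energyGrowth_first_of_le hα hp h1 hU hP
        · exact h.energyGrowth_first_of_gt_three_halves h2 hp hU hP
      refine ⟨C, hC0, fun R hR => ?_⟩
      rw [he0, hβ]
      exact hC R (by linarith)
    | succ k ih =>
      intro hk
      have hk' : k < N := Nat.lt_of_succ_le hk
      obtain ⟨C, hC0, hC⟩ := ih hk'.le
      have h0 : 0 ≤ e k := hbefore k hk'
      have h1 : e k ≤ 3 - 6 / p := (hmono k hk'.le).trans hβ3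
      obtain ⟨C', hC'0, hC'⟩ := h.energyGrowth_step hα hp hrange hU hP hPoisson hC0 h0 h1 hC
      refine ⟨C', hC'0, fun R hR => ?_⟩
      rw [hesucc]
      exact hC' R hR
  -- a negative growth exponent forces `U = 0`
  obtain ⟨C, -, hC⟩ := hgrowth N le_rfl
  have hα' : (3 : ℝ) / 2 < (3 - e N) / 2 := by linarith
  refine eq_zero_of_energyGrowth_of_three_halves_lt (L₀ := 1) (C := C) hα' hUc fun L hL => ?_
  rw [show 3 - 2 * ((3 - e N) / 2) = e N by ring]
  exact hC L hL

/-- **DISCHARGE of the named fact `chaeShvydkoy2013_Lp_exclusion`** (Chae–Shvydkoy 2013,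
Theorem 3.2, `N = 3`, every `3 ≤ p < ∞`): `p = 3` is the tree's `chaeShvydkoy2013_L3_exclusion`
(`SelfSimilarEulerL3Exclusion.lean`), `3 < p < ∞` is `IsSelfSimilarEulerProfile.eq_zero_of_memLp`.
[cite: ChaeShvydkoy2013, §3.2 Thm. 3.2] -/
theorem chaeShvydkoy2013_Lp_exclusion_holds : chaeShvydkoy2013_Lp_exclusion := by
  intro α p U P hα h3 htop hrange hprof hU hP hPoisson
  rcases eq_or_lt_of_le h3 with h3eq | h3lt
  · -- `p = 3`
    subst h3eq
    refine chaeShvydkoy2013_L3_exclusion α U P hα ?_ hprof hU hP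
    have e : (3 : ℝ) / (3 : ℝ≥0∞).toReal = 1 := by norm_num
    rwa [e] at hrange
  · -- `3 < p < ∞`
    have hpr : 3 < p.toReal := by
      have := (ENNReal.toReal_lt_toReal (by norm_num : (3 : ℝ≥0∞) ≠ ⊤) htop).2 h3lt
      simpa using this
    have hU' : MemLp U (ENNReal.ofReal p.toReal) volume := by rwa [ENNReal.ofReal_toReal htop]
    have hP' : MemLp P (ENNReal.ofReal (p.toReal / 2)) volume := by
      rw [ENNReal.ofReal_div_of_pos two_pos, ENNReal.ofReal_toReal htop]
      simpa using hP
    exact hprof.eq_zero_of_memLp hα hpr hrange hU' hP' hPoisson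

/-- Theorem 3.2 in the fact's own binder shape, as a theorem (for users who prefer not to
unfold the `def`). [cite: ChaeShvydkoy2013, §3.2 Thm. 3.2] -/
theorem chaeShvydkoy2013_Lp_exclusion_thm (α : ℝ) (p : ℝ≥0∞)
    (U : EuclideanSpace ℝ (Fin 3) → EuclideanSpace ℝ (Fin 3)) (P : EuclideanSpace ℝ (Fin 3) → ℝ)
    (hα : -1 < α) (h3 : 3 ≤ p) (htop : p ≠ ∞) (hrange : α ≤ 3 / p.toReal ∨ 3 / 2 < α)
    (hprof : IsSelfSimilarEulerProfile (1 / (α + 1)) 0 U P)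
    (hU : MemLp U p volume) (hP : MemLp P (p / 2) volume)
    (hPoisson : ∀ φ : EuclideanSpace ℝ (Fin 3) → ℝ, ContDiff ℝ (⊤ : ℕ∞) φ → HasCompactSupport φ →
      ∫ x, P x * (Δ φ) x = -∫ x, fderiv ℝ (fderiv ℝ φ) x (U x) (U x)) :
    U = 0 :=
  chaeShvydkoy2013_Lp_exclusion_holds α p U P hα h3 htop hrange hprof hU hP hPoisson

end Literature.Analysis.FluidPDE
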